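import Summits.AtomisticToContinuum.Crystallization.Theorems.PalmUnimodularRigidityLayeredLawsSelectHcpBallPositions
import Summits.AtomisticToContinuum.Crystallization.Theorems.FreeSplittingCertificatesStrictSplittingRuleCoreFirstOrderDesignGeometry

/-!
# Crux `LayeredLawsSelectHcp` (stmt-AtomisticToContinuum-9226), line `mtp-prestress-split-ergodic-frame`:
# single-star straightness of rooted charts (`tube_lineSecondDiff`, `tube_starChord`)

The far field of the rigidity certificate needs RANGE FLOORS for far chart labels
(`Cruxes/LayeredLawsSelectHcp/LeadC3FarField.md`); dead reckoning with frame comparisons (`tube_ballPositions`)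
drifts quadratically.  The cure is SINGLE-STAR straightness, with NO frame comparison: at every label `u` of a rooted
labelled chart `X` of an every-point-good hcp-charted `S`, the star of the re-rooted chart `reRoot X u`
(`reRoot X u e = X (labelShift u e) − X u`) is fitted within `a_u/100` by ONE frame `(a_u, A_u)`, `a_u ∈ [9/10, 1]`
(`exists_frame_reRoot`, i.e. `tube_chartStarFrame` for the translated configuration).  Hence:

* `tube_lineSecondDiff`: for an in-layer star label `e` (`e.1 = 0`) the label `−e` is again a star label
  (`neg_mem_hcpStarIdx`) with `hcpSite 1 √(2/3) (−e) = −hcpSite 1 √(2/3) e` (the landed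
  `StrictSplittingRuleBirth.h1_neg_of_even`), so the two antipodal
  bonds `X (labelShift u (±e)) − X u` are within `a_u/100` of `± a_u • A_u (hcpSite 1 √(2/3) e)`: their sum, the second
  difference `X (labelShift u e) + X (labelShift u (−e)) − 2 • X u` of the lattice line, has norm `≤ 2 a_u/100 ≤ 1/50`;
* `tube_starChord`: for two star labels `e, e'` the chord `(X (labelShift u e) − X u) − (X (labelShift u e') − X u)` is
  within `2 a_u/100` of `a_u • A_u (hcpSite 1 √(2/3) e − hcpSite 1 √(2/3) e')`, of norm `a_u ‖hcpSite … e − hcpSite … e'‖`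
  (`A_u` a linear isometry), whence the two-sided estimate with `9/10 ≤ a_u ≤ 1`.

All `[folklore]`.
-/

noncomputable section

namespace Summit.AtomisticToContinuum.Crystallization.Theorems.PalmUnimodularRigidity.LayeredLawsSelectHcp

open MeasureTheory Set
open Literature.MathematicalPhysics.StatisticalMechanics Literature.Geometry.DiscreteGeometry
open Summit.AtomisticToContinuum.Crystallization.Theorems.LayeredLawsSelectHcp.Negative.DiracLaws (GoodShell)

/-! ## The in-layer star labels under negation -/

/-- The six in-layer star labels are closed under negation. [folklore] -/
theorem neg_mem_hcpStarIdx {e : ℤ × ℤ × ℤ} (he : e ∈ hcpStarIdx) (h0 : e.1 = 0) : -e ∈ hcpStarIdx := by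
  revert e
  decide

/-! ## Normed-space bookkeeping -/

/-- **Two bonds fitted by one frame, summed**: `‖p − f‖ ≤ η` and `‖q + f‖ ≤ η` give `‖p + q‖ ≤ η + η`. [folklore] -/
theorem norm_add_le_of_fit {V : Type*} [NormedAddCommGroup V] {p q f : V} {η : ℝ} (hp : ‖p - f‖ ≤ η)
    (hq : ‖q + f‖ ≤ η) : ‖p + q‖ ≤ η + η := by
  have e : p + q = (p - f) + (q + f) := by abel
  rw [e]
  exact (norm_add_le _ _).trans (add_le_add hp hq)

/-- **Two bonds fitted by one frame, subtracted**: `‖p − f‖ ≤ η` and `‖q − g‖ ≤ η` give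
`‖p − q‖ ≤ ‖f − g‖ + (η + η)` and `‖f − g‖ − (η + η) ≤ ‖p − q‖`. [folklore] -/
theorem norm_sub_fit {V : Type*} [NormedAddCommGroup V] {p q f g : V} {η : ℝ} (hp : ‖p - f‖ ≤ η)
    (hq : ‖q - g‖ ≤ η) : ‖p - q‖ ≤ ‖f - g‖ + (η + η) ∧ ‖f - g‖ - (η + η) ≤ ‖p - q‖ := by
  have e : p - q = (f - g) + ((p - f) - (q - g)) := by abel
  have hd : ‖(p - f) - (q - g)‖ ≤ η + η := (norm_sub_le _ _).trans (add_le_add hp hq)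
  rw [e]
  constructor
  · exact (norm_add_le _ _).trans (by linarith)
  · have := norm_sub_norm_le (f - g) (-((p - f) - (q - g)))
    rw [sub_neg_eq_add, norm_neg] at this
    linarith

/-! ## The registered stubs -/

/-- **Registered sub-goal `tube_lineSecondDiff`: lattice lines of a rooted chart are straight to second order.**  For an
every-point-good hcp-charted `S ∋ 0`, a rooted labelled chart `X` of `S`, a label `u` and an in-layer star label `e`
(`e ∈ hcpStarIdx`, `e.1 = 0`), the second difference `X (labelShift u e) + X (labelShift u (−e)) − 2 • X u` has norm
`≤ 1/50`: the star of `reRoot X u` is fitted within `a_u/100` by one frame `(a_u, A_u)`, `a_u ≤ 1` (`exists_frame_reRoot`),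
`−e` is a star label (`neg_mem_hcpStarIdx`) and `hcpSite 1 √(2/3) (−e) = −hcpSite 1 √(2/3) e` (the landed
`StrictSplittingRuleBirth.h1_neg_of_even`), so the two antipodal bonds are within `a_u/100` of opposite vectors. [folklore] -/
theorem tube_lineSecondDiff : ∀ S : Set (EuclideanSpace ℝ (Fin 3)), ∀ X : ℤ × ℤ × ℤ → EuclideanSpace ℝ (Fin 3), (0 : EuclideanSpace ℝ (Fin 3)) ∈ S → (∀ x ∈ S, GoodShell S x) → HcpCharted S → IsRootedChart S X → ∀ u e : ℤ × ℤ × ℤ, e ∈ hcpStarIdx → e.1 = 0 → ‖X (labelShift u e) + X (labelShift u (-e)) - (2 : ℝ) • X u‖ ≤ 1 / 50 := by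
  intro S X _ hgood hch hX u e he he0
  obtain ⟨a, _, h1, A, hA⟩ := exists_frame_reRoot hgood hch hX u
  have hp := hA e he
  have hq := hA (-e) (neg_mem_hcpStarIdx he he0)
  have hev : Even e.1 := by rw [he0]; exact Even.zero
  rw [StrictSplittingRuleBirth.h1_neg_of_even _ _ hev, map_neg, smul_neg, sub_neg_eq_add] at hq
  simp only [reRoot] at hp hq
  have e2 : X (labelShift u e) + X (labelShift u (-e)) - (2 : ℝ) • X u =
      (X (labelShift u e) - X u) + (X (labelShift u (-e)) - X u) := by module
  rw [e2]
  refine (norm_add_le_of_fit hp hq).trans ?_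
  linarith

/-- **Registered sub-goal `tube_starChord`: two bonds at one label realise the ideal chord.**  For an every-point-good
hcp-charted `S ∋ 0`, a rooted labelled chart `X` of `S`, a label `u` and star labels `e, e'`, the chord between the bonds
`X (labelShift u e) − X u` and `X (labelShift u e') − X u` has norm within `+1/50` of the ideal chord
`‖hcpSite 1 √(2/3) e − hcpSite 1 √(2/3) e'‖` from above and at least `9/10` of it minus `1/50` from below: both bonds are
fitted within `a_u/100` by ONE frame `(a_u, A_u)`, `9/10 ≤ a_u ≤ 1` (`exists_frame_reRoot`), and
`‖a_u • A_u (x − y)‖ = a_u ‖x − y‖` for the linear isometry `A_u`. [folklore] -/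
theorem tube_starChord : ∀ S : Set (EuclideanSpace ℝ (Fin 3)), ∀ X : ℤ × ℤ × ℤ → EuclideanSpace ℝ (Fin 3), (0 : EuclideanSpace ℝ (Fin 3)) ∈ S → (∀ x ∈ S, GoodShell S x) → HcpCharted S → IsRootedChart S X → ∀ u e e' : ℤ × ℤ × ℤ, e ∈ hcpStarIdx → e' ∈ hcpStarIdx → ‖(X (labelShift u e) - X u) - (X (labelShift u e') - X u)‖ ≤ ‖hcpSite 1 (Real.sqrt (2 / 3)) e - hcpSite 1 (Real.sqrt (2 / 3)) e'‖ + 1 / 50 ∧ 9 / 10 * ‖hcpSite 1 (Real.sqrt (2 / 3)) e - hcpSite 1 (Real.sqrt (2 / 3)) e'‖ - 1 / 50 ≤ ‖(X (labelShift u e) - X u) - (X (labelShift u e') - X u)‖ := by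
  intro S X _ hgood hch hX u e e' he he'
  obtain ⟨a, h9, h1, A, hA⟩ := exists_frame_reRoot hgood hch hX u
  have hp := hA e he
  have hq := hA e' he'
  simp only [reRoot] at hp hq
  obtain ⟨hup, hlo⟩ := norm_sub_fit hp hq
  have hn : ‖a • A (hcpSite 1 (Real.sqrt (2 / 3)) e) - a • A (hcpSite 1 (Real.sqrt (2 / 3)) e')‖ =
      a * ‖hcpSite 1 (Real.sqrt (2 / 3)) e - hcpSite 1 (Real.sqrt (2 / 3)) e'‖ := by
    rw [← smul_sub, ← map_sub, norm_smul, LinearIsometryEquiv.norm_map, Real.norm_of_nonneg (by linarith)]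
  rw [hn] at hup hlo
  have hD : 0 ≤ ‖hcpSite 1 (Real.sqrt (2 / 3)) e - hcpSite 1 (Real.sqrt (2 / 3)) e'‖ := norm_nonneg _
  constructor
  · nlinarith
  · nlinarith

end Summit.AtomisticToContinuum.Crystallization.Theorems.PalmUnimodularRigidity.LayeredLawsSelectHcp

end
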